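import Summits.CriticalPhenomena.PercolationContinuityZ3.Theorems.PercNearOneGluingNoHeavyLowerTailKnQuestion8CoefficientwiseCoreClassSeriesCells
import Summits.CriticalPhenomena.PercolationContinuityZ3.Theorems.PercNearOneGluingNoHeavyLowerTailKnQuestion8CoefficientwiseCoreClassSeriesC6
import Summits.CriticalPhenomena.PercolationContinuityZ3.Theorems.PercNearOneGluingNoHeavyLowerTailKnQuestion8CoefficientwiseCoreClassKernelWrapper
import HarnessLib

/-!
# THEOREM KB-SERIES (conditional on the one-sided root inequality)

Support file (`--supports stmt-CriticalPhenomena-4575`, closed), prover `prim-cplus-coupling` (gen 31).  No definitions, no notations, no named facts,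
no sorries; standard axioms.  Memo `prim-cplus-coupling/A5-COUPLING-gen31.md` §2b.  Assembles `…CoreClassSeriesCells` (cells E, C1, C3),
`…CoreClassSeriesC6` (the contact cell) and `…CoreClassSeriesClusters`.

Setting: SERIES COMPOSITION of middle graphs.  Edge sets `E₁, E₂` (disjoint) whose edges meet only at the cut vertex `c`; terminal `a` on no edge of
`E₂`, terminal `b` on no edge of `E₁`; `a, b, c` distinct.  PROPER DOMINATION MAPS `ψ₁` of `(E₁; a, c)` and `ψ₂` of `(E₂; c, b)`.
* `Coefficientwise.sum_powerset_union_disjoint` — `Σ_{ω ⊆ E₁ ∪ E₂} f ω = Σ_{ω₁ ⊆ E₁} Σ_{ω₂ ⊆ E₂} f(ω₁ ∪ ω₂)`.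
* `Coefficientwise.seriesCell_C6` — the contact cell of the composed graph in composed-cluster form, from `seriesC6_of_oneSidedRoot`.
* `Coefficientwise.coreClass_kernelMixFull_series` — **KB-MIX-FULL for `(E₁ ∪ E₂; a, b)`** (all levels) from `ψ₁`, `ψ₂` and the ONE-SIDED ROOT
  INEQUALITY `OSR(E₁; c, a)`: `∀ H ≥ Hᵇ ≥ 0, K ≥ Kᵇ ≥ 0 monotone, Σ_{a ∈ C_c ω₁ ∖ C_c(E₁∖ω₁)} (H(C_c ω₁) − Hᵇ(C_c(E₁∖ω₁)))(K(C_c ω₁) − Kᵇ(C_c(E₁∖ω₁))) ≥ 0`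
  (census-clean for all graphs on ≤ 7 vertices, memo §2b).  Proof: the wall of the composed graph is the disjoint union of the cells E, C1, C3, C6 and the
  supply dominates the four disjoint slices they are paid from.
* `Coefficientwise.cwpa_coreClass_of_series` — hence CW-PA (all monotone `f, g`) on the core class `N(x) = N(z) = {a, b}` over `E₁ ∪ E₂`.
The unconditional instances (`a` adjacent to all of `H₁`, where OSR is elementary) are in `…CoreClassSeriesAdj`.
[cite: KozmaNitzan2024, Questions 8–9 (§5.5 p. 36) (context: the Question-8 pocket covariance programme)]
-/

namespace Summit.CriticalPhenomena.PercolationContinuityZ3.Theorems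

open Finset Literature.Probability.Percolation

namespace Coefficientwise

variable {ι V : Type*}

/-- A sum over the configurations of a disjoint union is a double sum. [cite: KozmaNitzan2024, §5.5 (context only; folklore)] -/
theorem sum_powerset_union_disjoint [DecidableEq ι] {A B : Finset ι} (hAB : Disjoint A B) (f : Finset ι → ℝ) :
    ∑ S ∈ (A ∪ B).powerset, f S = ∑ T ∈ A.powerset, ∑ R ∈ B.powerset, f (T ∪ R) := by
  induction A using Finset.induction_on generalizing f with
  | empty => simp only [Finset.empty_union, Finset.powerset_empty, Finset.sum_singleton]
  | @insert e A heA ih =>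
    have heB : e ∉ B := fun h => (Finset.disjoint_insert_left.1 hAB).1 h
    have hAB' : Disjoint A B := (Finset.disjoint_insert_left.1 hAB).2
    have heAB : e ∉ A ∪ B := by rw [Finset.mem_union, not_or]; exact ⟨heA, heB⟩
    rw [Finset.insert_union, Finset.sum_powerset_insert heAB, Finset.sum_powerset_insert heA, ih hAB' f,
      ih hAB' (fun S => f (insert e S))]
    congr 1
    refine Finset.sum_congr rfl fun T _ => Finset.sum_congr rfl fun R _ => ?_
    rw [Finset.insert_union]

open Classical in
/-- **Cell C6 (contact at the cut vertex) in composed form.**  Under the one-sided root inequality for `(E₁; c, a)`, the contact cell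
`{c ∈ C_a ω₁ ∖ C_a(E₁∖ω₁)} × {b ∈ C_c(E₂∖ω₂) ∖ C_c ω₂}` of the wall of the composed graph is paid by the supply slice
`{c ∈ C_a ω₁ ∖ C_a(E₁∖ω₁)} × {b ∈ C_c ω₂ ∖ C_c(E₂∖ω₂)}`. [cite: KozmaNitzan2024, Questions 8–9 (§5.5 p. 36) (context)] -/
theorem seriesCell_C6 (ends : ι → Sym2 V) (E₁ E₂ : Finset ι) (c a b : V)
    (hsep : ∀ i ∈ E₁, ∀ j ∈ E₂, ∀ u, u ∈ ends i → u ∈ ends j → u = c)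
    (haE : ∀ j ∈ E₂, a ∉ ends j) (hbE : ∀ i ∈ E₁, b ∉ ends i)
    (h k ha hb ka kb : Set V → ℝ) (hh : Monotone h) (hk : Monotone k)
    (mha : Monotone ha) (mhb : Monotone hb) (mka : Monotone ka) (mkb : Monotone kb)
    (ha0 : ∀ X, 0 ≤ ha X) (hah : ∀ X, ha X ≤ h X) (hb0 : ∀ X, 0 ≤ hb X) (hbh : ∀ X, hb X ≤ h X)
    (ka0 : ∀ X, 0 ≤ ka X) (kak : ∀ X, ka X ≤ k X) (kb0 : ∀ X, 0 ≤ kb X) (kbk : ∀ X, kb X ≤ k X)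
    (hOSR : ∀ H Hb K Kb : Set V → ℝ, Monotone H → Monotone Hb → Monotone K → Monotone Kb →
      (∀ X, 0 ≤ Hb X) → (∀ X, Hb X ≤ H X) → (∀ X, 0 ≤ Kb X) → (∀ X, Kb X ≤ K X) →
      0 ≤ ∑ ω₁ ∈ E₁.powerset, (if a ∈ openCluster (ends '' (↑ω₁ : Set ι)) c ∧ a ∉ openCluster (ends '' (↑(E₁ \ ω₁) : Set ι)) c then
        (H (openCluster (ends '' (↑ω₁ : Set ι)) c) - Hb (openCluster (ends '' (↑(E₁ \ ω₁) : Set ι)) c)) *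
          (K (openCluster (ends '' (↑ω₁ : Set ι)) c) - Kb (openCluster (ends '' (↑(E₁ \ ω₁) : Set ι)) c)) else 0)) :
    0 ≤ ∑ ω₁ ∈ E₁.powerset, ∑ ω₂ ∈ E₂.powerset,
      ((if (c ∈ openCluster (ends '' (↑ω₁ : Set ι)) a ∧ c ∉ openCluster (ends '' (↑(E₁ \ ω₁) : Set ι)) a) ∧
            (b ∈ openCluster (ends '' (↑ω₂ : Set ι)) c ∧ b ∉ openCluster (ends '' (↑(E₂ \ ω₂) : Set ι)) c) then
          h (openCluster (ends '' (↑(ω₁ ∪ ω₂) : Set ι)) a ∪ openCluster (ends '' (↑(ω₁ ∪ ω₂) : Set ι)) b) *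
            k (openCluster (ends '' (↑(ω₁ ∪ ω₂) : Set ι)) a ∪ openCluster (ends '' (↑(ω₁ ∪ ω₂) : Set ι)) b) else 0)
      + (if (c ∈ openCluster (ends '' (↑ω₁ : Set ι)) a ∧ c ∉ openCluster (ends '' (↑(E₁ \ ω₁) : Set ι)) a) ∧
            (b ∈ openCluster (ends '' (↑(E₂ \ ω₂) : Set ι)) c ∧ b ∉ openCluster (ends '' (↑ω₂ : Set ι)) c) then
          (ha (openCluster (ends '' (↑(ω₁ ∪ ω₂) : Set ι)) a) - hb (openCluster (ends '' (↑((E₁ \ ω₁) ∪ (E₂ \ ω₂)) : Set ι)) b)) *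
            (ka (openCluster (ends '' (↑(ω₁ ∪ ω₂) : Set ι)) a) - kb (openCluster (ends '' (↑((E₁ \ ω₁) ∪ (E₂ \ ω₂)) : Set ι)) b)) else 0)) := by
  set C : Finset ι → V → Set V := fun ω v => openCluster (ends '' (↑ω : Set ι)) v with hC
  change 0 ≤ ∑ ω₁ ∈ E₁.powerset, ∑ ω₂ ∈ E₂.powerset,
      ((if (c ∈ C ω₁ a ∧ c ∉ C (E₁ \ ω₁) a) ∧ (b ∈ C ω₂ c ∧ b ∉ C (E₂ \ ω₂) c) then
          h (C (ω₁ ∪ ω₂) a ∪ C (ω₁ ∪ ω₂) b) * k (C (ω₁ ∪ ω₂) a ∪ C (ω₁ ∪ ω₂) b) else 0)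
      + (if (c ∈ C ω₁ a ∧ c ∉ C (E₁ \ ω₁) a) ∧ (b ∈ C (E₂ \ ω₂) c ∧ b ∉ C ω₂ c) then
          (ha (C (ω₁ ∪ ω₂) a) - hb (C ((E₁ \ ω₁) ∪ (E₂ \ ω₂)) b)) * (ka (C (ω₁ ∪ ω₂) a) - kb (C ((E₁ \ ω₁) ∪ (E₂ \ ω₂)) b)) else 0))
  have base := seriesC6_of_oneSidedRoot ends E₁ E₂ c a b h k ha hb ka kb hh hk mha mhb mka mkb ha0 hah hb0 hbh ka0 kak kb0 kbk hOSR
  change 0 ≤ ∑ ω₁ ∈ E₁.powerset, (if a ∈ C ω₁ c ∧ a ∉ C (E₁ \ ω₁) c then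
      ∑ ω₂ ∈ E₂.powerset, ((if b ∈ C ω₂ c ∧ b ∉ C (E₂ \ ω₂) c then h (C ω₁ c ∪ C ω₂ c) * k (C ω₁ c ∪ C ω₂ c) else 0)
        + (if b ∈ C (E₂ \ ω₂) c ∧ b ∉ C ω₂ c then (ha (C ω₁ c ∪ C ω₂ c) - hb (C (E₁ \ ω₁) c ∪ C (E₂ \ ω₂) c)) * (ka (C ω₁ c ∪ C ω₂ c) - kb (C (E₁ \ ω₁) c ∪ C (E₂ \ ω₂) c)) else 0))
      else 0) at base
  have hCmono : ∀ {ω ω' : Finset ι} (v : V), ω ⊆ ω' → C ω v ⊆ C ω' v := fun v hle => openCluster_image_mono ends hle v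
  have hh0 : ∀ X, 0 ≤ h X := fun X => le_trans (ha0 X) (hah X)
  have hk0 : ∀ X, 0 ≤ k X := fun X => le_trans (ka0 X) (kak X)
  have cutA : ∀ ω₁ ω₂ : Finset ι, ω₁ ⊆ E₁ → ω₂ ⊆ E₂ → C (ω₁ ∪ ω₂) a = C ω₁ a ∪ {y | c ∈ C ω₁ a ∧ y ∈ C ω₂ c} :=
    fun ω₁ ω₂ h1 h2 => openCluster_cut_side ends E₁ E₂ ω₁ ω₂ c a hsep h1 h2 haE
  have cutB : ∀ ω₁ ω₂ : Finset ι, ω₁ ⊆ E₁ → ω₂ ⊆ E₂ → C (ω₁ ∪ ω₂) b = C ω₂ b ∪ {y | c ∈ C ω₂ b ∧ y ∈ C ω₁ c} := by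
    intro ω₁ ω₂ h1 h2
    rw [Finset.union_comm]
    exact openCluster_cut_side ends E₂ E₁ ω₂ ω₁ c b (fun i hi j hj u hui huj => hsep j hj i hi u huj hui) h2 h1 hbE
  -- a cluster containing `c` is the cluster of `c`
  have clEq : ∀ (ω : Finset ι) (v : V), c ∈ C ω v → C ω v = C ω c := by
    intro ω v hv
    ext y
    exact ⟨fun hy => SimpleGraph.Reachable.trans (SimpleGraph.Reachable.symm hv) hy, fun hy => SimpleGraph.Reachable.trans hv hy⟩
  refine le_trans base (Finset.sum_le_sum fun ω₁ hω₁ => ?_)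
  have hω₁ := Finset.mem_powerset.mp hω₁
  by_cases hR : c ∈ C ω₁ a ∧ c ∉ C (E₁ \ ω₁) a
  · have hR' : a ∈ C ω₁ c ∧ a ∉ C (E₁ \ ω₁) c :=
      ⟨(mem_openCluster_comm ends ω₁ a c).mp hR.1, fun hx => hR.2 ((mem_openCluster_comm ends (E₁ \ ω₁) a c).mpr hx)⟩
    rw [if_pos hR']
    refine Finset.sum_le_sum fun ω₂ hω₂ => ?_
    have hω₂ := Finset.mem_powerset.mp hω₂
    have hX1 : C ω₁ a = C ω₁ c := clEq ω₁ a hR.1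
    apply add_le_add
    · by_cases h2 : b ∈ C ω₂ c ∧ b ∉ C (E₂ \ ω₂) c
      · rw [if_pos h2, if_pos ⟨hR, h2⟩]
        -- S ⊇ X₁ ∪ X₂
        have hsub : C ω₁ c ∪ C ω₂ c ⊆ C (ω₁ ∪ ω₂) a ∪ C (ω₁ ∪ ω₂) b := by
          intro y hy
          have hca : c ∈ C (ω₁ ∪ ω₂) a := hCmono a Finset.subset_union_left hR.1
          rcases hy with hy | hy
          · exact Or.inl (SimpleGraph.Reachable.trans hca (hCmono c Finset.subset_union_left hy))
          · exact Or.inl (SimpleGraph.Reachable.trans hca (hCmono c Finset.subset_union_right hy))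
        exact mul_le_mul (hh hsub) (hk hsub) (hk0 _) (hh0 _)
      · rw [if_neg h2, if_neg (fun hx => h2 hx.2)]
    · by_cases h2 : b ∈ C (E₂ \ ω₂) c ∧ b ∉ C ω₂ c
      · rw [if_pos h2, if_pos ⟨hR, h2⟩]
        -- P = X₁ ∪ X₂ and Q = Y₁ ∪ Y₂
        have hP : C (ω₁ ∪ ω₂) a = C ω₁ c ∪ C ω₂ c := by
          rw [cutA ω₁ ω₂ hω₁ hω₂, hX1]
          ext y
          constructor
          · rintro (hy | ⟨_, hy⟩); exact Or.inl hy; exact Or.inr hy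
          · rintro (hy | hy); exact Or.inl hy; exact Or.inr ⟨by rw [← hX1]; exact hR.1, hy⟩
        have hcb : c ∈ C (E₂ \ ω₂) b := (mem_openCluster_comm ends (E₂ \ ω₂) c b).mp h2.1
        have hY2 : C (E₂ \ ω₂) b = C (E₂ \ ω₂) c := clEq (E₂ \ ω₂) b hcb
        have hQ : C ((E₁ \ ω₁) ∪ (E₂ \ ω₂)) b = C (E₁ \ ω₁) c ∪ C (E₂ \ ω₂) c := by
          rw [cutB (E₁ \ ω₁) (E₂ \ ω₂) Finset.sdiff_subset Finset.sdiff_subset, hY2]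
          ext y
          constructor
          · rintro (hy | ⟨_, hy⟩); exact Or.inr hy; exact Or.inl hy
          · rintro (hy | hy); exact Or.inr ⟨by rw [← hY2]; exact hcb, hy⟩; exact Or.inl hy
        rw [hP, hQ]
      · rw [if_neg h2, if_neg (fun hx => h2 hx.2)]
  · have hR' : ¬ (a ∈ C ω₁ c ∧ a ∉ C (E₁ \ ω₁) c) := fun hx =>
      hR ⟨(mem_openCluster_comm ends ω₁ a c).mpr hx.1, fun hy => hx.2 ((mem_openCluster_comm ends (E₁ \ ω₁) a c).mp hy)⟩
    rw [if_neg hR']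
    refine Finset.sum_nonneg fun ω₂ _ => ?_
    rw [if_neg (fun hx => hR hx.1), if_neg (fun hx => hR hx.1)]; linarith

open Classical in
/-- **KB-MIX-FULL for a series composition.**  Edge sets `E₁, E₂` (disjoint) meeting only at the cut vertex `c`; `a` on no edge of `E₂`, `b` on no edge of
`E₁`, `b ≠ a`; proper domination maps `ψ₁` of `(E₁; a, c)` and `ψ₂` of `(E₂; c, b)`; the one-sided root inequality for `(E₁; c, a)`.  Then for all monotone
`h, k` and monotone levels `0 ≤ hᵃ, hᵇ ≤ h`, `0 ≤ kᵃ, kᵇ ≤ k`, with `E = E₁ ∪ E₂`: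
`0 ≤ Σ_{ω ⊆ E} h(C_a ω ∪ C_b ω)k(C_a ω ∪ C_b ω) + Σ_{ω ⊆ E : b ∉ C_a ω, b ∉ C_a(E∖ω)} (hᵃ(C_a ω) − hᵇ(C_b(E∖ω)))(kᵃ(C_a ω) − kᵇ(C_b(E∖ω)))`.
[cite: KozmaNitzan2024, Questions 8–9 (§5.5 p. 36) (context)] -/
theorem coreClass_kernelMixFull_series (ends : ι → Sym2 V) (E₁ E₂ : Finset ι) (c a b : V) (hdisj : Disjoint E₁ E₂)
    (hsep : ∀ i ∈ E₁, ∀ j ∈ E₂, ∀ u, u ∈ ends i → u ∈ ends j → u = c)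
    (haE : ∀ j ∈ E₂, a ∉ ends j) (hbE : ∀ i ∈ E₁, b ∉ ends i) (hba : b ≠ a)
    (h k ha hb ka kb : Set V → ℝ) (hh : Monotone h) (hk : Monotone k)
    (mha : Monotone ha) (mhb : Monotone hb) (mka : Monotone ka) (mkb : Monotone kb)
    (ha0 : ∀ X, 0 ≤ ha X) (hah : ∀ X, ha X ≤ h X) (hb0 : ∀ X, 0 ≤ hb X) (hbh : ∀ X, hb X ≤ h X)
    (ka0 : ∀ X, 0 ≤ ka X) (kak : ∀ X, ka X ≤ k X) (kb0 : ∀ X, 0 ≤ kb X) (kbk : ∀ X, kb X ≤ k X)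
    (ψ₁ : Finset ι → Finset ι)
    (hψ₁E : ∀ ω, ω ⊆ E₁ → c ∉ openCluster (ends '' (↑ω : Set ι)) a → c ∉ openCluster (ends '' (↑(E₁ \ ω) : Set ι)) a → ψ₁ ω ⊆ E₁)
    (hψ₁cov : ∀ ω, ω ⊆ E₁ → c ∉ openCluster (ends '' (↑ω : Set ι)) a → c ∉ openCluster (ends '' (↑(E₁ \ ω) : Set ι)) a →
      openCluster (ends '' (↑ω : Set ι)) a ∪ openCluster (ends '' (↑(E₁ \ ω) : Set ι)) c ⊆
        openCluster (ends '' (↑(ψ₁ ω) : Set ι)) a ∪ openCluster (ends '' (↑(ψ₁ ω) : Set ι)) c)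
    (hψ₁inj : ∀ ω ω', ω ⊆ E₁ → c ∉ openCluster (ends '' (↑ω : Set ι)) a → c ∉ openCluster (ends '' (↑(E₁ \ ω) : Set ι)) a →
      ω' ⊆ E₁ → c ∉ openCluster (ends '' (↑ω' : Set ι)) a → c ∉ openCluster (ends '' (↑(E₁ \ ω') : Set ι)) a → ψ₁ ω = ψ₁ ω' → ω = ω')
    (hψ₁prop : ∀ ω, ω ⊆ E₁ → c ∉ openCluster (ends '' (↑ω : Set ι)) a → c ∉ openCluster (ends '' (↑(E₁ \ ω) : Set ι)) a →
      c ∉ openCluster (ends '' (↑(ψ₁ ω) : Set ι)) a)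
    (ψ₂ : Finset ι → Finset ι)
    (hψ₂E : ∀ ω, ω ⊆ E₂ → b ∉ openCluster (ends '' (↑ω : Set ι)) c → b ∉ openCluster (ends '' (↑(E₂ \ ω) : Set ι)) c → ψ₂ ω ⊆ E₂)
    (hψ₂cov : ∀ ω, ω ⊆ E₂ → b ∉ openCluster (ends '' (↑ω : Set ι)) c → b ∉ openCluster (ends '' (↑(E₂ \ ω) : Set ι)) c →
      openCluster (ends '' (↑ω : Set ι)) c ∪ openCluster (ends '' (↑(E₂ \ ω) : Set ι)) b ⊆
        openCluster (ends '' (↑(ψ₂ ω) : Set ι)) c ∪ openCluster (ends '' (↑(ψ₂ ω) : Set ι)) b)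
    (hψ₂inj : ∀ ω ω', ω ⊆ E₂ → b ∉ openCluster (ends '' (↑ω : Set ι)) c → b ∉ openCluster (ends '' (↑(E₂ \ ω) : Set ι)) c →
      ω' ⊆ E₂ → b ∉ openCluster (ends '' (↑ω' : Set ι)) c → b ∉ openCluster (ends '' (↑(E₂ \ ω') : Set ι)) c → ψ₂ ω = ψ₂ ω' → ω = ω')
    (hψ₂prop : ∀ ω, ω ⊆ E₂ → b ∉ openCluster (ends '' (↑ω : Set ι)) c → b ∉ openCluster (ends '' (↑(E₂ \ ω) : Set ι)) c →
      b ∉ openCluster (ends '' (↑(ψ₂ ω) : Set ι)) c)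
    (hOSR : ∀ H Hb K Kb : Set V → ℝ, Monotone H → Monotone Hb → Monotone K → Monotone Kb →
      (∀ X, 0 ≤ Hb X) → (∀ X, Hb X ≤ H X) → (∀ X, 0 ≤ Kb X) → (∀ X, Kb X ≤ K X) →
      0 ≤ ∑ ω₁ ∈ E₁.powerset, (if a ∈ openCluster (ends '' (↑ω₁ : Set ι)) c ∧ a ∉ openCluster (ends '' (↑(E₁ \ ω₁) : Set ι)) c then
        (H (openCluster (ends '' (↑ω₁ : Set ι)) c) - Hb (openCluster (ends '' (↑(E₁ \ ω₁) : Set ι)) c)) *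
          (K (openCluster (ends '' (↑ω₁ : Set ι)) c) - Kb (openCluster (ends '' (↑(E₁ \ ω₁) : Set ι)) c)) else 0)) :
    0 ≤ (∑ ω ∈ (E₁ ∪ E₂).powerset,
        h (openCluster (ends '' (↑ω : Set ι)) a ∪ openCluster (ends '' (↑ω : Set ι)) b) *
          k (openCluster (ends '' (↑ω : Set ι)) a ∪ openCluster (ends '' (↑ω : Set ι)) b))
      + ∑ ω ∈ (E₁ ∪ E₂).powerset.filter (fun ω : Finset ι => b ∉ openCluster (ends '' (↑ω : Set ι)) a ∧
            b ∉ openCluster (ends '' (↑((E₁ ∪ E₂) \ ω) : Set ι)) a),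
        (ha (openCluster (ends '' (↑ω : Set ι)) a) - hb (openCluster (ends '' (↑((E₁ ∪ E₂) \ ω) : Set ι)) b)) *
          (ka (openCluster (ends '' (↑ω : Set ι)) a) - kb (openCluster (ends '' (↑((E₁ ∪ E₂) \ ω) : Set ι)) b)) := by
  set C : Finset ι → V → Set V := fun ω v => openCluster (ends '' (↑ω : Set ι)) v with hC
  change 0 ≤ (∑ ω ∈ (E₁ ∪ E₂).powerset, h (C ω a ∪ C ω b) * k (C ω a ∪ C ω b))
      + ∑ ω ∈ (E₁ ∪ E₂).powerset.filter (fun ω : Finset ι => b ∉ C ω a ∧ b ∉ C ((E₁ ∪ E₂) \ ω) a),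
        (ha (C ω a) - hb (C ((E₁ ∪ E₂) \ ω) b)) * (ka (C ω a) - kb (C ((E₁ ∪ E₂) \ ω) b))
  have hh0 : ∀ X, 0 ≤ h X := fun X => le_trans (ha0 X) (hah X)
  have hk0 : ∀ X, 0 ≤ k X := fun X => le_trans (ka0 X) (kak X)
  -- the four cells
  have cE := seriesCell_E ends E₁ E₂ c a b hsep haE hbE h k ha hb ka kb hh hk ha0 hah hb0 hbh ka0 kak kb0 kbk
  have c3 := seriesCell_C3 ends E₁ E₂ c a b hsep haE hbE h k ha hb ka kb hh hk ha0 hah hb0 hbh ka0 kak kb0 kbk ψ₂ hψ₂E hψ₂cov hψ₂inj hψ₂prop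
  have c1 := seriesCell_C1 ends E₁ E₂ c a b hsep haE hbE h k ha hb ka kb hh hk ha0 hah hb0 hbh ka0 kak kb0 kbk ψ₁ hψ₁E hψ₁cov hψ₁inj hψ₁prop
  have c6 := seriesCell_C6 ends E₁ E₂ c a b hsep haE hbE h k ha hb ka kb hh hk mha mhb mka mkb ha0 hah hb0 hbh ka0 kak kb0 kbk hOSR
  change 0 ≤ ∑ ω₁ ∈ E₁.powerset, ∑ ω₂ ∈ E₂.powerset,
      ((if c ∉ C ω₁ a ∧ b ∉ C ω₂ c then h (C (ω₁ ∪ ω₂) a ∪ C (ω₁ ∪ ω₂) b) * k (C (ω₁ ∪ ω₂) a ∪ C (ω₁ ∪ ω₂) b) else 0)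
      + (if c ∉ C ω₁ a ∧ b ∉ C (E₂ \ ω₂) c then
          (ha (C (ω₁ ∪ ω₂) a) - hb (C ((E₁ \ ω₁) ∪ (E₂ \ ω₂)) b)) * (ka (C (ω₁ ∪ ω₂) a) - kb (C ((E₁ \ ω₁) ∪ (E₂ \ ω₂)) b)) else 0)) at cE
  change 0 ≤ ∑ ω₁ ∈ E₁.powerset, ∑ ω₂ ∈ E₂.powerset,
      ((if c ∈ C ω₁ a ∧ b ∉ C ω₂ c then h (C (ω₁ ∪ ω₂) a ∪ C (ω₁ ∪ ω₂) b) * k (C (ω₁ ∪ ω₂) a ∪ C (ω₁ ∪ ω₂) b) else 0)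
      + (if c ∈ C ω₁ a ∧ (b ∉ C ω₂ c ∧ b ∉ C (E₂ \ ω₂) c) then
          (ha (C (ω₁ ∪ ω₂) a) - hb (C ((E₁ \ ω₁) ∪ (E₂ \ ω₂)) b)) * (ka (C (ω₁ ∪ ω₂) a) - kb (C ((E₁ \ ω₁) ∪ (E₂ \ ω₂)) b)) else 0)) at c3
  change 0 ≤ ∑ ω₁ ∈ E₁.powerset, ∑ ω₂ ∈ E₂.powerset,
      ((if c ∉ C ω₁ a ∧ b ∈ C ω₂ c then h (C (ω₁ ∪ ω₂) a ∪ C (ω₁ ∪ ω₂) b) * k (C (ω₁ ∪ ω₂) a ∪ C (ω₁ ∪ ω₂) b) else 0)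
      + (if (c ∉ C ω₁ a ∧ c ∉ C (E₁ \ ω₁) a) ∧ b ∈ C (E₂ \ ω₂) c then
          (ha (C (ω₁ ∪ ω₂) a) - hb (C ((E₁ \ ω₁) ∪ (E₂ \ ω₂)) b)) * (ka (C (ω₁ ∪ ω₂) a) - kb (C ((E₁ \ ω₁) ∪ (E₂ \ ω₂)) b)) else 0)) at c1
  change 0 ≤ ∑ ω₁ ∈ E₁.powerset, ∑ ω₂ ∈ E₂.powerset,
      ((if (c ∈ C ω₁ a ∧ c ∉ C (E₁ \ ω₁) a) ∧ (b ∈ C ω₂ c ∧ b ∉ C (E₂ \ ω₂) c) then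
          h (C (ω₁ ∪ ω₂) a ∪ C (ω₁ ∪ ω₂) b) * k (C (ω₁ ∪ ω₂) a ∪ C (ω₁ ∪ ω₂) b) else 0)
      + (if (c ∈ C ω₁ a ∧ c ∉ C (E₁ \ ω₁) a) ∧ (b ∈ C (E₂ \ ω₂) c ∧ b ∉ C ω₂ c) then
          (ha (C (ω₁ ∪ ω₂) a) - hb (C ((E₁ \ ω₁) ∪ (E₂ \ ω₂)) b)) * (ka (C (ω₁ ∪ ω₂) a) - kb (C ((E₁ \ ω₁) ∪ (E₂ \ ω₂)) b)) else 0)) at c6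
  -- rewrite the target as a double sum
  rw [Finset.sum_filter, sum_powerset_union_disjoint hdisj, sum_powerset_union_disjoint hdisj, ← Finset.sum_add_distrib]
  have hfour : ∑ ω₁ ∈ E₁.powerset, ((∑ ω₂ ∈ E₂.powerset, h (C (ω₁ ∪ ω₂) a ∪ C (ω₁ ∪ ω₂) b) * k (C (ω₁ ∪ ω₂) a ∪ C (ω₁ ∪ ω₂) b))
      + ∑ ω₂ ∈ E₂.powerset, (if b ∉ C (ω₁ ∪ ω₂) a ∧ b ∉ C ((E₁ ∪ E₂) \ (ω₁ ∪ ω₂)) a then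
          (ha (C (ω₁ ∪ ω₂) a) - hb (C ((E₁ ∪ E₂) \ (ω₁ ∪ ω₂)) b)) * (ka (C (ω₁ ∪ ω₂) a) - kb (C ((E₁ ∪ E₂) \ (ω₁ ∪ ω₂)) b)) else 0))
      ≥ (∑ ω₁ ∈ E₁.powerset, ∑ ω₂ ∈ E₂.powerset,
        ((if c ∉ C ω₁ a ∧ b ∉ C ω₂ c then h (C (ω₁ ∪ ω₂) a ∪ C (ω₁ ∪ ω₂) b) * k (C (ω₁ ∪ ω₂) a ∪ C (ω₁ ∪ ω₂) b) else 0)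
        + (if c ∉ C ω₁ a ∧ b ∉ C (E₂ \ ω₂) c then
            (ha (C (ω₁ ∪ ω₂) a) - hb (C ((E₁ \ ω₁) ∪ (E₂ \ ω₂)) b)) * (ka (C (ω₁ ∪ ω₂) a) - kb (C ((E₁ \ ω₁) ∪ (E₂ \ ω₂)) b)) else 0)))
      + (∑ ω₁ ∈ E₁.powerset, ∑ ω₂ ∈ E₂.powerset,
        ((if c ∈ C ω₁ a ∧ b ∉ C ω₂ c then h (C (ω₁ ∪ ω₂) a ∪ C (ω₁ ∪ ω₂) b) * k (C (ω₁ ∪ ω₂) a ∪ C (ω₁ ∪ ω₂) b) else 0)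
        + (if c ∈ C ω₁ a ∧ (b ∉ C ω₂ c ∧ b ∉ C (E₂ \ ω₂) c) then
            (ha (C (ω₁ ∪ ω₂) a) - hb (C ((E₁ \ ω₁) ∪ (E₂ \ ω₂)) b)) * (ka (C (ω₁ ∪ ω₂) a) - kb (C ((E₁ \ ω₁) ∪ (E₂ \ ω₂)) b)) else 0)))
      + (∑ ω₁ ∈ E₁.powerset, ∑ ω₂ ∈ E₂.powerset,
        ((if c ∉ C ω₁ a ∧ b ∈ C ω₂ c then h (C (ω₁ ∪ ω₂) a ∪ C (ω₁ ∪ ω₂) b) * k (C (ω₁ ∪ ω₂) a ∪ C (ω₁ ∪ ω₂) b) else 0)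
        + (if (c ∉ C ω₁ a ∧ c ∉ C (E₁ \ ω₁) a) ∧ b ∈ C (E₂ \ ω₂) c then
            (ha (C (ω₁ ∪ ω₂) a) - hb (C ((E₁ \ ω₁) ∪ (E₂ \ ω₂)) b)) * (ka (C (ω₁ ∪ ω₂) a) - kb (C ((E₁ \ ω₁) ∪ (E₂ \ ω₂)) b)) else 0)))
      + (∑ ω₁ ∈ E₁.powerset, ∑ ω₂ ∈ E₂.powerset,
        ((if (c ∈ C ω₁ a ∧ c ∉ C (E₁ \ ω₁) a) ∧ (b ∈ C ω₂ c ∧ b ∉ C (E₂ \ ω₂) c) then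
            h (C (ω₁ ∪ ω₂) a ∪ C (ω₁ ∪ ω₂) b) * k (C (ω₁ ∪ ω₂) a ∪ C (ω₁ ∪ ω₂) b) else 0)
        + (if (c ∈ C ω₁ a ∧ c ∉ C (E₁ \ ω₁) a) ∧ (b ∈ C (E₂ \ ω₂) c ∧ b ∉ C ω₂ c) then
            (ha (C (ω₁ ∪ ω₂) a) - hb (C ((E₁ \ ω₁) ∪ (E₂ \ ω₂)) b)) * (ka (C (ω₁ ∪ ω₂) a) - kb (C ((E₁ \ ω₁) ∪ (E₂ \ ω₂)) b)) else 0))) := by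
    rw [ge_iff_le, ← Finset.sum_add_distrib, ← Finset.sum_add_distrib, ← Finset.sum_add_distrib]
    refine Finset.sum_le_sum fun ω₁ hω₁ => ?_
    have hω₁ := Finset.mem_powerset.mp hω₁
    rw [← Finset.sum_add_distrib, ← Finset.sum_add_distrib, ← Finset.sum_add_distrib, ← Finset.sum_add_distrib]
    refine Finset.sum_le_sum fun ω₂ hω₂ => ?_
    have hω₂ := Finset.mem_powerset.mp hω₂
    -- translate the wall condition and the complement
    have hsd : (E₁ ∪ E₂) \ (ω₁ ∪ ω₂) = (E₁ \ ω₁) ∪ (E₂ \ ω₂) := sdiff_union_sdiff E₁ E₂ ω₁ ω₂ hdisj hω₁ hω₂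
    have hfar1 : b ∈ C (ω₁ ∪ ω₂) a ↔ c ∈ C ω₁ a ∧ b ∈ C ω₂ c :=
      mem_openCluster_cut_far ends E₁ E₂ ω₁ ω₂ c a b hsep hω₁ hω₂ haE hbE hba
    have hfar2 : b ∈ C ((E₁ \ ω₁) ∪ (E₂ \ ω₂)) a ↔ c ∈ C (E₁ \ ω₁) a ∧ b ∈ C (E₂ \ ω₂) c :=
      mem_openCluster_cut_far ends E₁ E₂ (E₁ \ ω₁) (E₂ \ ω₂) c a b hsep Finset.sdiff_subset Finset.sdiff_subset haE hbE hba
    rw [hsd]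
    set Y : ℝ := h (C (ω₁ ∪ ω₂) a ∪ C (ω₁ ∪ ω₂) b) * k (C (ω₁ ∪ ω₂) a ∪ C (ω₁ ∪ ω₂) b) with hY
    set M : ℝ := (ha (C (ω₁ ∪ ω₂) a) - hb (C ((E₁ \ ω₁) ∪ (E₂ \ ω₂)) b)) * (ka (C (ω₁ ∪ ω₂) a) - kb (C ((E₁ \ ω₁) ∪ (E₂ \ ω₂)) b)) with hM
    have hY0 : 0 ≤ Y := mul_nonneg (hh0 _) (hk0 _)
    have hwall : (b ∉ C (ω₁ ∪ ω₂) a ∧ b ∉ C ((E₁ \ ω₁) ∪ (E₂ \ ω₂)) a) ↔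
        (¬ (c ∈ C ω₁ a ∧ b ∈ C ω₂ c) ∧ ¬ (c ∈ C (E₁ \ ω₁) a ∧ b ∈ C (E₂ \ ω₂) c)) := by rw [hfar1, hfar2]
    rw [show (if b ∉ C (ω₁ ∪ ω₂) a ∧ b ∉ C ((E₁ \ ω₁) ∪ (E₂ \ ω₂)) a then M else 0) =
        (if (¬ (c ∈ C ω₁ a ∧ b ∈ C ω₂ c) ∧ ¬ (c ∈ C (E₁ \ ω₁) a ∧ b ∈ C (E₂ \ ω₂) c)) then M else 0) from by
      by_cases hw : b ∉ C (ω₁ ∪ ω₂) a ∧ b ∉ C ((E₁ \ ω₁) ∪ (E₂ \ ω₂)) a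
      · rw [if_pos hw, if_pos (hwall.mp hw)]
      · rw [if_neg hw, if_neg (fun hx => hw (hwall.mpr hx))]]
    by_cases h1 : c ∈ C ω₁ a <;> by_cases h2 : c ∈ C (E₁ \ ω₁) a <;> by_cases h3 : b ∈ C ω₂ c <;> by_cases h4 : b ∈ C (E₂ \ ω₂) c <;>
      simp [h1, h2, h3, h4] <;> linarith
  have hge := hfour
  linarith [cE, c3, c1, c6]

open Classical in
/-- **THEOREM KB-SERIES (conditional) — CW-PA on the core class `N(x) = N(z) = {a, b}` over a series composition `E₁ ·_c E₂`.**
Core-class bookkeeping for the middle graph `E_H = E₁ ∪ E₂` (terminals `a, b` joined to `x, z` by `ixa, ixb, iza, izb`; no edge of `E_H` at `x, z`);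
`E₁, E₂` disjoint, meeting only at `c`; `a` on no edge of `E₂`, `b` on no edge of `E₁`, `b ≠ a`; proper domination maps `ψ₁` of `(E₁; a, c)` and `ψ₂` of
`(E₂; c, b)`; the one-sided root inequality for `(E₁; c, a)`.  Then for all monotone `f, g`:
`0 ≤ Σ_{s ⊆ E₀ : z ∉ C_x(s), z ∉ C_x(E₀∖s)} f(C_x s)·(g(C_x s) − g(C_x(E₀∖s)))`. [cite: KozmaNitzan2024, Questions 8–9 (§5.5 p. 36) (context)] -/
theorem cwpa_coreClass_of_series (ends : ι → Sym2 V) (E₁ E₂ E₀ : Finset ι) (x z c a b : V) (ixa ixb iza izb : ι) (hdisj : Disjoint E₁ E₂)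
    (hsep : ∀ i ∈ E₁, ∀ j ∈ E₂, ∀ u, u ∈ ends i → u ∈ ends j → u = c)
    (haE : ∀ j ∈ E₂, a ∉ ends j) (hbE : ∀ i ∈ E₁, b ∉ ends i) (hba : b ≠ a)
    (hxa : ends ixa = s(x, a)) (hxb : ends ixb = s(x, b)) (hza : ends iza = s(z, a)) (hzb : ends izb = s(z, b))
    (hH : ∀ i ∈ E₁ ∪ E₂, x ∉ ends i ∧ z ∉ ends i) (hE₀ : ∀ i, i ∈ E₀ ↔ i ∈ E₁ ∪ E₂ ∨ i = ixa ∨ i = ixb ∨ i = iza ∨ i = izb)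
    (hnot : ixa ∉ E₁ ∪ E₂ ∧ ixb ∉ E₁ ∪ E₂ ∧ iza ∉ E₁ ∪ E₂ ∧ izb ∉ E₁ ∪ E₂)
    (hd : ixa ≠ ixb ∧ ixa ≠ iza ∧ ixa ≠ izb ∧ ixb ≠ iza ∧ ixb ≠ izb ∧ iza ≠ izb)
    (hxz : x ≠ z) (hxa' : x ≠ a) (hxb' : x ≠ b) (hza' : z ≠ a) (hzb' : z ≠ b)
    (ψ₁ : Finset ι → Finset ι)
    (hψ₁E : ∀ ω, ω ⊆ E₁ → c ∉ openCluster (ends '' (↑ω : Set ι)) a → c ∉ openCluster (ends '' (↑(E₁ \ ω) : Set ι)) a → ψ₁ ω ⊆ E₁)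
    (hψ₁cov : ∀ ω, ω ⊆ E₁ → c ∉ openCluster (ends '' (↑ω : Set ι)) a → c ∉ openCluster (ends '' (↑(E₁ \ ω) : Set ι)) a →
      openCluster (ends '' (↑ω : Set ι)) a ∪ openCluster (ends '' (↑(E₁ \ ω) : Set ι)) c ⊆
        openCluster (ends '' (↑(ψ₁ ω) : Set ι)) a ∪ openCluster (ends '' (↑(ψ₁ ω) : Set ι)) c)
    (hψ₁inj : ∀ ω ω', ω ⊆ E₁ → c ∉ openCluster (ends '' (↑ω : Set ι)) a → c ∉ openCluster (ends '' (↑(E₁ \ ω) : Set ι)) a →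
      ω' ⊆ E₁ → c ∉ openCluster (ends '' (↑ω' : Set ι)) a → c ∉ openCluster (ends '' (↑(E₁ \ ω') : Set ι)) a → ψ₁ ω = ψ₁ ω' → ω = ω')
    (hψ₁prop : ∀ ω, ω ⊆ E₁ → c ∉ openCluster (ends '' (↑ω : Set ι)) a → c ∉ openCluster (ends '' (↑(E₁ \ ω) : Set ι)) a →
      c ∉ openCluster (ends '' (↑(ψ₁ ω) : Set ι)) a)
    (ψ₂ : Finset ι → Finset ι)
    (hψ₂E : ∀ ω, ω ⊆ E₂ → b ∉ openCluster (ends '' (↑ω : Set ι)) c → b ∉ openCluster (ends '' (↑(E₂ \ ω) : Set ι)) c → ψ₂ ω ⊆ E₂)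
    (hψ₂cov : ∀ ω, ω ⊆ E₂ → b ∉ openCluster (ends '' (↑ω : Set ι)) c → b ∉ openCluster (ends '' (↑(E₂ \ ω) : Set ι)) c →
      openCluster (ends '' (↑ω : Set ι)) c ∪ openCluster (ends '' (↑(E₂ \ ω) : Set ι)) b ⊆
        openCluster (ends '' (↑(ψ₂ ω) : Set ι)) c ∪ openCluster (ends '' (↑(ψ₂ ω) : Set ι)) b)
    (hψ₂inj : ∀ ω ω', ω ⊆ E₂ → b ∉ openCluster (ends '' (↑ω : Set ι)) c → b ∉ openCluster (ends '' (↑(E₂ \ ω) : Set ι)) c →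
      ω' ⊆ E₂ → b ∉ openCluster (ends '' (↑ω' : Set ι)) c → b ∉ openCluster (ends '' (↑(E₂ \ ω') : Set ι)) c → ψ₂ ω = ψ₂ ω' → ω = ω')
    (hψ₂prop : ∀ ω, ω ⊆ E₂ → b ∉ openCluster (ends '' (↑ω : Set ι)) c → b ∉ openCluster (ends '' (↑(E₂ \ ω) : Set ι)) c →
      b ∉ openCluster (ends '' (↑(ψ₂ ω) : Set ι)) c)
    (hOSR : ∀ H Hb K Kb : Set V → ℝ, Monotone H → Monotone Hb → Monotone K → Monotone Kb →
      (∀ X, 0 ≤ Hb X) → (∀ X, Hb X ≤ H X) → (∀ X, 0 ≤ Kb X) → (∀ X, Kb X ≤ K X) →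
      0 ≤ ∑ ω₁ ∈ E₁.powerset, (if a ∈ openCluster (ends '' (↑ω₁ : Set ι)) c ∧ a ∉ openCluster (ends '' (↑(E₁ \ ω₁) : Set ι)) c then
        (H (openCluster (ends '' (↑ω₁ : Set ι)) c) - Hb (openCluster (ends '' (↑(E₁ \ ω₁) : Set ι)) c)) *
          (K (openCluster (ends '' (↑ω₁ : Set ι)) c) - Kb (openCluster (ends '' (↑(E₁ \ ω₁) : Set ι)) c)) else 0))
    (f g : Set V → ℝ) (hf : Monotone f) (hg : Monotone g) :
    0 ≤ ∑ s ∈ E₀.powerset.filter (fun s : Finset ι => z ∉ openCluster (ends '' (↑s : Set ι)) x ∧ z ∉ openCluster (ends '' (↑(E₀ \ s) : Set ι)) x),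
      f (openCluster (ends '' (↑s : Set ι)) x) * (g (openCluster (ends '' (↑s : Set ι)) x) - g (openCluster (ends '' (↑(E₀ \ s) : Set ι)) x)) := by
  refine cwpa_coreClass_of_kernel ends (E₁ ∪ E₂) E₀ x z a b ixa ixb iza izb hxa hxb hza hzb hH hE₀ hnot hd hxz hxa' hxb' hza' hzb' ?_ f g hf hg
  intro f' g' hf' hf0' hg'
  have hf_nonneg : ∀ X : Set V, 0 ≤ f' X := fun X => by rw [← hf0']; exact hf' (Set.empty_subset X)
  have hgm : Monotone (fun X : Set V => g' X - g' ∅) := fun X Y hXY => sub_le_sub_right (hg' hXY) _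
  have hg0 : ∀ X : Set V, 0 ≤ g' X - g' ∅ := fun X => sub_nonneg.mpr (hg' (Set.empty_subset X))
  refine coreClass_kernel_nonneg_of_kernelMixFull ends (E₁ ∪ E₂) a b f' g' ?_
  exact coreClass_kernelMixFull_series ends E₁ E₂ c a b hdisj hsep haE hbE hba f' (fun X => g' X - g' ∅) f' f' (fun X => g' X - g' ∅)
    (fun X => g' X - g' ∅) hf' hgm hf' hf' hgm hgm hf_nonneg (fun X => le_refl _) hf_nonneg (fun X => le_refl _)
    hg0 (fun X => le_refl _) hg0 (fun X => le_refl _) ψ₁ hψ₁E hψ₁cov hψ₁inj hψ₁prop ψ₂ hψ₂E hψ₂cov hψ₂inj hψ₂prop hOSR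

end Coefficientwise

end Summit.CriticalPhenomena.PercolationContinuityZ3.Theorems
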